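import Mathlib
import Summits.Ventures.HodgeRepro.Tier4.Target
import Summits.Ventures.HodgeRepro.Tier4.Line3.KMDatum
import Summits.Ventures.HodgeRepro.Tier4.Line3.KMDatumS
import Summits.Ventures.HodgeRepro.Tier4.Line3.Defs

/-!
# Tier4/Line3/CoefInvariance — `Γ′`-invariance of the Hecke-moved coefficient functions (L3.6a, step R1)

Blind re-derivation cell `pub-hodge-repro`, Tier 4 «PROVE THE STEP» (README §9–§10), LINE L3, seat t4-L3-p1 (prover);
support (S4a) of L3.6a `term_main_unfold` (lead S12253): step (R1) of the skeleton's docstring — `coefQ γ` is constant on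
`Γ′`-classes.

CONTENT.  A Hecke element of level `Γ′` is a combination of double cosets `Γ′ g Γ′`, each given by a complete system `R`
of representatives of the right cosets `Γ′ r ⊆ Γ′ g Γ′` (`IsCosetReps`, Target.lean §D).  Right multiplication by
`γ ∈ Γ′` permutes these cosets: for `r ∈ R` there is a unique `σ r ∈ R` with `r γ ∈ Γ′ (σ r)` (`exists_rep_mul`,
`rep_unique`), and `σ` is a bijection of `R` (`exists_rep_mul` for the inverse of `γ`).  Hence for a `Γ`-invariant
coefficient function `c` (`ThetaData.invΓ`), `Σ_{r ∈ R} c(r γ x) = Σ_{r ∈ R} c(σ r · x) = Σ_{r ∈ R} c(r x)`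
(`sum_reps_mulVec_mem`), so `heckeAct h c (γ x) = heckeAct h c x` (`heckeAct_mulVec_mem`) and
`coefQ cf γ (g • x) = coefQ cf γ x` for `g ∈ Γ′` (`coefQ_mulVec_mem`).

Nothing here asserts anything about the truth of (P); HC_CM is NOT proved by anyone in this repository.
-/

set_option autoImplicit false

noncomputable section

namespace Summit.Ventures.HodgeRepro.Tier4.Line3

open Summit.Ventures.HodgeRepro.Tier4
open Matrix
open scoped ComplexConjugate

/-! ## 1. Coset representatives under right multiplication -/

section Reps

variable {E : Type*} [Field E] {c : E ≃+* E} {H : Matrix (Fin 3) (Fin 3) E} {Γ : Set (Matrix (Fin 3) (Fin 3) E)}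

/-- In a congruence subgroup every element has a two-sided inverse in the subgroup. -/
theorem exists_inv_mem (hΓ : IsCongruenceSubgroup c H Γ) {γ : Matrix (Fin 3) (Fin 3) E} (hγ : γ ∈ Γ) :
    ∃ γ' ∈ Γ, γ * γ' = 1 ∧ γ' * γ = 1 := by
  obtain ⟨γ', hγ', h⟩ := hΓ.2.2.1 γ hγ
  exact ⟨γ', hγ', h, mul_eq_one_comm.mp h⟩

/-- Two representatives in one right coset `Γ r` coincide. -/
theorem rep_unique (hΓ : IsCongruenceSubgroup c H Γ) {g : Matrix (Fin 3) (Fin 3) E}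
    {R : Finset (Matrix (Fin 3) (Fin 3) E)} (hR : IsCosetReps Γ g R) {r₁ r₂ : Matrix (Fin 3) (Fin 3) E}
    (h₁ : r₁ ∈ R) (h₂ : r₂ ∈ R) {δ : Matrix (Fin 3) (Fin 3) E} (hδ : δ ∈ Γ) (h : r₁ = δ * r₂) : r₁ = r₂ := by
  obtain ⟨γ₁, hγ₁, γ₂, hγ₂, hr₂⟩ := hR.1 r₂ h₂
  obtain ⟨δ', hδ', hδδ', hδ'δ⟩ := exists_inv_mem hΓ hδ
  have hu := hR.2 γ₁ hγ₁ γ₂ hγ₂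
  have e₂ : r₂ ∈ R ∧ ∃ γ ∈ Γ, γ₁ * g * γ₂ = γ * r₂ := ⟨h₂, 1, hΓ.1, by rw [← hr₂, Matrix.one_mul]⟩
  have e₁ : r₁ ∈ R ∧ ∃ γ ∈ Γ, γ₁ * g * γ₂ = γ * r₁ :=
    ⟨h₁, δ', hδ', by rw [← hr₂, h, ← Matrix.mul_assoc, hδ'δ, Matrix.one_mul]⟩
  exact hu.unique e₁ e₂

/-- For `r ∈ R` and `γ ∈ Γ` the product `r γ` lies in the right coset of a representative. -/
theorem exists_rep_mul (hΓ : IsCongruenceSubgroup c H Γ) {g : Matrix (Fin 3) (Fin 3) E}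
    {R : Finset (Matrix (Fin 3) (Fin 3) E)} (hR : IsCosetReps Γ g R) {r : Matrix (Fin 3) (Fin 3) E} (hr : r ∈ R)
    {γ : Matrix (Fin 3) (Fin 3) E} (hγ : γ ∈ Γ) : ∃ r' ∈ R, ∃ δ ∈ Γ, r * γ = δ * r' := by
  obtain ⟨γ₁, hγ₁, γ₂, hγ₂, hr⟩ := hR.1 r hr
  obtain ⟨r', ⟨hr', δ, hδ, hδr'⟩, _⟩ := hR.2 γ₁ hγ₁ (γ₂ * γ) (hΓ.2.1 γ₂ hγ₂ γ hγ)
  refine ⟨r', hr', δ, hδ, ?_⟩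
  rw [hr, Matrix.mul_assoc (γ₁ * g) γ₂ γ]
  exact hδr'

/-- **Right multiplication by `γ ∈ Γ` permutes the representatives**: for a `Γ`-invariant `c`,
`Σ_{r ∈ R} c (r γ x) = Σ_{r ∈ R} c (r x)`. -/
theorem sum_reps_mulVec_mem (hΓ : IsCongruenceSubgroup c H Γ) {g : Matrix (Fin 3) (Fin 3) E}
    {R : Finset (Matrix (Fin 3) (Fin 3) E)} (hR : IsCosetReps Γ g R) {f : (Fin 3 → E) → ℂ}
    (hf : ∀ δ ∈ Γ, ∀ x, f (δ *ᵥ x) = f x) {γ : Matrix (Fin 3) (Fin 3) E} (hγ : γ ∈ Γ) (x : Fin 3 → E) :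
    ∑ r ∈ R, f (r *ᵥ (γ *ᵥ x)) = ∑ r ∈ R, f (r *ᵥ x) := by
  obtain ⟨γ', hγ', hγγ', hγ'γ⟩ := exists_inv_mem hΓ hγ
  -- the permutation `σ`
  have hσ : ∀ r ∈ R, ∃ r' ∈ R, ∃ δ ∈ Γ, r * γ = δ * r' := fun r hr => exists_rep_mul hΓ hR hr hγ
  refine Finset.sum_bij (fun r hr => Classical.choose (hσ r hr)) (fun r hr => (Classical.choose_spec (hσ r hr)).1)
    ?_ ?_ ?_
  · -- injective
    intro r₁ hr₁ r₂ hr₂ heq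
    obtain ⟨hm₁, δ₁, hδ₁, e₁⟩ := Classical.choose_spec (hσ r₁ hr₁)
    obtain ⟨hm₂, δ₂, hδ₂, e₂⟩ := Classical.choose_spec (hσ r₂ hr₂)
    generalize Classical.choose (hσ r₁ hr₁) = s₁ at heq e₁ hm₁
    generalize Classical.choose (hσ r₂ hr₂) = s₂ at heq e₂ hm₂
    subst heq
    obtain ⟨ε₂, hε₂, hδε₂, hε₂δ⟩ := exists_inv_mem hΓ hδ₂
    -- `r₁ = δ₁ ε₂ r₂`
    have key : r₁ = (δ₁ * ε₂) * r₂ := by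
      calc r₁ = r₁ * γ * γ' := by rw [Matrix.mul_assoc, hγγ', Matrix.mul_one]
        _ = δ₁ * s₁ * γ' := by rw [e₁]
        _ = δ₁ * (ε₂ * (δ₂ * s₁)) * γ' := by rw [← Matrix.mul_assoc ε₂, hε₂δ, Matrix.one_mul]
        _ = δ₁ * (ε₂ * (r₂ * γ)) * γ' := by rw [e₂]
        _ = (δ₁ * ε₂) * (r₂ * (γ * γ')) := by simp only [Matrix.mul_assoc]
        _ = (δ₁ * ε₂) * r₂ := by rw [hγγ', Matrix.mul_one]
    exact rep_unique hΓ hR hr₁ hr₂ (hΓ.2.1 δ₁ hδ₁ ε₂ hε₂) key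
  · -- surjective
    intro r' hr'
    obtain ⟨r, hr, δ, hδ, e⟩ := exists_rep_mul hΓ hR hr' hγ'
    refine ⟨r, hr, ?_⟩
    obtain ⟨hm, η, hη, e''⟩ := Classical.choose_spec (hσ r hr)
    generalize Classical.choose (hσ r hr) = s at hm e'' ⊢
    obtain ⟨ε, hε, hδε, hεδ⟩ := exists_inv_mem hΓ hδ
    -- `r γ = ε r'`, so `η s = ε r'`
    have hrγ : r * γ = ε * r' := by
      calc r * γ = ε * (δ * r) * γ := by rw [← Matrix.mul_assoc, hεδ, Matrix.one_mul]
        _ = ε * (r' * γ') * γ := by rw [e]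
        _ = ε * r' := by rw [Matrix.mul_assoc, Matrix.mul_assoc, hγ'γ, Matrix.mul_one]
    obtain ⟨θ, hθ, hηθ, hθη⟩ := exists_inv_mem hΓ hη
    have key : s = (θ * ε) * r' := by
      calc s = θ * (η * s) := by rw [← Matrix.mul_assoc, hθη, Matrix.one_mul]
        _ = θ * (r * γ) := by rw [e'']
        _ = (θ * ε) * r' := by rw [hrγ, Matrix.mul_assoc]
    exact rep_unique hΓ hR hm hr' (hΓ.2.1 θ hθ ε hε) key
  · -- the summands agree
    intro r hr
    obtain ⟨_, δ, hδ, e⟩ := Classical.choose_spec (hσ r hr)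
    generalize Classical.choose (hσ r hr) = s at e ⊢
    rw [Matrix.mulVec_mulVec, e, ← Matrix.mulVec_mulVec, hf δ hδ]

end Reps

/-! ## 2. `Γ′`-invariance of `heckeAct` and `coefQ` -/

namespace T4Data

variable (X : T4Data)

/-- `heckeAct h c` is `Γ′`-invariant for `h` of level `Γ′` and `c` `Γ`-invariant. -/
theorem heckeAct_mulVec_mem (K : X.Level) {h : HeckeElement X.E} (hh : h.IsFor X.c X.H K.1)
    {c : (Fin 3 → X.E) → ℂ} (hc : ∀ δ ∈ X.Γ, ∀ x, c (δ *ᵥ x) = c x)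
    {γ : Matrix (Fin 3) (Fin 3) X.E} (hγ : γ ∈ K.1) (x : Fin 3 → X.E) :
    X.heckeAct h c (γ *ᵥ x) = X.heckeAct h c x := by
  unfold T4Data.heckeAct
  congr 1
  refine List.map_congr_left fun t ht => ?_
  obtain ⟨g, _, hR⟩ := hh t ht
  congr 1
  exact sum_reps_mulVec_mem K.2.1 hR (fun δ hδ x => hc δ (K.2.2 hδ) x) hγ x

/-- **`coefQ` IS CONSTANT ON `Γ′`-CLASSES** (step R1 of L3.6a): for `g ∈ Γ′` and `Γ`-invariant slot coefficients,
`coefQ cf γ (g • x) = coefQ cf γ x`. -/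
theorem coefQ_mulVec_mem {K : X.Level} (cf : Fin 4 → (Fin 3 → X.E) → ℂ)
    (hcf : ∀ j, ∀ δ ∈ X.Γ, ∀ x, cf j (δ *ᵥ x) = cf j x) (γ : X.Tr K)
    {g : Matrix (Fin 3) (Fin 3) X.E} (hg : g ∈ K.1) (x : X.Tuple) :
    X.coefQ cf γ (fun j => g *ᵥ x j) = X.coefQ cf γ x := by
  unfold T4Data.coefQ
  refine Finsupp.sum_congr fun h _ => ?_
  simp only [X.heckeAct_mulVec_mem K (h.2 _) (hcf _) hg]

/-- The same for the slot coefficients of an identification datum (`ThetaData.invΓ`). -/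
theorem coefQ_mulVec_mem_of_thetaData {K : X.Level} (D : X.ThetaData) (γ : X.Tr K)
    {g : Matrix (Fin 3) (Fin 3) X.E} (hg : g ∈ K.1) (x : X.Tuple) :
    X.coefQ D.cf γ (fun j => g *ᵥ x j) = X.coefQ D.cf γ x :=
  X.coefQ_mulVec_mem D.cf D.invΓ γ hg x

end T4Data

end Summit.Ventures.HodgeRepro.Tier4.Line3

end
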